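import Summits.AtomisticToContinuum.HydrodynamicLimit.Theorems.EnskogAdjointDualityAdjointEnskogTestFamilyRDefectSplit
import Summits.AtomisticToContinuum.HydrodynamicLimit.Theorems.EnskogAdjointDualityAdjointEnskogTestFamilyRFluidMoments
import Summits.AtomisticToContinuum.HydrodynamicLimit.Theorems.EnskogAdjointDualityAdjointEnskogTestFamilyRTransferReduction
import Summits.AtomisticToContinuum.HydrodynamicLimit.Theorems.EnskogAdjointDualityAdjointEnskogTestFamilyRTransferBound
import Summits.AtomisticToContinuum.HydrodynamicLimit.Theorems.EnskogAdjointDualityAdjointEnskogTestFamilyRCorrectorEstimate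
import Summits.AtomisticToContinuum.HydrodynamicLimit.Theorems.EnskogAdjointDualityAdjointEnskogTestFamilyRConsistencyAssembly
import HarnessLib

/-!
# K2R, clause (v): Euler–Enskog consistency of the local Maxwellian (`EnskogConsistency`) — PROVED

Route `EnskogAdjointDuality` of `AtomisticToContinuum/HydrodynamicLimit`, crux `AdjointEnskogTestFamilyR`
(K2R, stmt-AtomisticToContinuum-11592), line `birth`, stub statement B of the birth skeleton
(`Cruxes/AdjointEnskogTestFamilyR/Lines/birth.lean`, Prop `EnskogConsistency`): along every packing-guarded
classical hard-sphere Euler solution in an EOS window and for EVERY admissible family `(c^N, κ^N)` of test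
functions `φ^N = α + β·v + γ|v|²/2 + κ^N/λ_N` that is eventually `C¹` along free flights and approximately dual
(`|Dφ^N + L^Nφ^N| ≤ η_N(1+|v|²)`), the Enskog defect of the Euler local Maxwellian `f = ρM_{1,θ,u}` tested on the
family, `Res_N = ∫∫ f_tφ^N_t − ∫∫ f_0φ^N_0 − ∫₀ᵗ∫∫ f (Dφ^N + ½L^Nφ^N)`, tends to `0` — hs-Euler pressure
`ρθZ(ρσ³)` ⇔ Enskog collisional transfer at contact value `Y = (3/2π)f_ex'`, `(2π/3)ηY(η) = Z(η) − 1`,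
`λ_Nε_N → σ³`.

This file only composes the landed pieces of the line: the defect split (G1, `stub_defectSplit`), the fluid side
(G2, `stub_fluidMoments`), the collisional transfer of the hydrodynamic part (G3a `stub_transferReduction`,
G3b `stub_transferBound`), the corrector bounds (G4, `stub_correctorEstimate`) and the limit bookkeeping
(G5, `stub_consistencyAssembly`), themselves built on the generic lemmas B1–B4 of the line
(`stub_telescopeProduct`, `stub_maxwellianCharDeriv`, `stub_pairGaussian`, `stub_spatialTransfer`,
`stub_correctorBalance`). With this theorem the crux K2R is reduced to its kinetic half, the backward-family
construction `BackwardFamily` (stub A of the skeleton).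

References: C. Cercignani, R. Illner, M. Pulvirenti, *The Mathematical Theory of Dilute Gases* (1994), §3.1, §3.3
[CIP1994]; M. Lachowicz, Arch. Mech. 50 (1998) (hydrodynamic limit of the Enskog equation) [Lachowicz1998];
H. van Beijeren, M. H. Ernst, Physica 68 (1973) 437–456 [VanbeijerenErnst1973].
-/

namespace Summit.AtomisticToContinuum.HydrodynamicLimit.Theorems.EnskogAdjointDuality

/-- **G3 — collisional transfer of the hydrodynamic part = excess-pressure work at rate `λ_Nε_N`, up to
`O(λ_Nε_N²)`** (the skeleton's Prop `TransferEstimate`, verbatim): composition of the reduction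
`stub_transferReduction` (`B_ψ = λ_N T`) with the position × direction bound `stub_transferBound`.
[cite: CIP1994, §3.1] -/
theorem k2r_transferEstimate :
  ∀ (η₁ : ℝ), 0 < η₁ → AnalyticOnNhd ℝ Literature.MathematicalPhysics.KineticTheory.hsExcessFreeEnergy (Set.Ioo 0 η₁) →
  ∀ (σ T : ℝ), 0 < σ → σ ≤ 1 → ∀ (ρ θ : ℝ → UnitAddTorus (Fin 3) → ℝ) (u : ℝ → UnitAddTorus (Fin 3) → EuclideanSpace ℝ (Fin 3)),
  Literature.MathematicalPhysics.KineticTheory.IsHardSphereEulerSolution σ T ρ u θ →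
  ∀ t ∈ Set.Ioo 0 T, (∀ s ∈ Set.Icc 0 t, ∀ x, ρ s x * σ ^ 3 < η₁) →
  ∀ (c : ℕ → ℝ → UnitAddTorus (Fin 3) → ℝ × EuclideanSpace ℝ (Fin 3) × ℝ) (κ : ℕ → ℝ → UnitAddTorus (Fin 3) → EuclideanSpace ℝ (Fin 3) → ℝ),
  (∀ N, Continuous (Function.uncurry (c N))) →
  (∀ N, Continuous (fun p : ℝ × UnitAddTorus (Fin 3) × EuclideanSpace ℝ (Fin 3) => κ N p.1 p.2.1 p.2.2)) →
  ∀ (C : ℝ), (∀ N s x x' v v', ‖c N s x‖ ≤ C ∧ dist (c N s x) (c N s x') ≤ C * dist x x' ∧ |κ N s x v| ≤ C * (1 + ‖v‖ ^ 2) ∧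
    |κ N s x v - κ N s x' v'| ≤ C * (1 + ‖v‖ ^ 2 + ‖v'‖ ^ 2) * (dist x x' + ‖v - v'‖)) →
  (let G := Literature.Analysis.FluidPDE.Torus.geometry (Fin 3)
   let ε := fun N : ℕ => Literature.MathematicalPhysics.KineticTheory.hsDiameter σ N
   let lam := fun N : ℕ => (N : ℝ) * ε N ^ 2
   let f := fun (s : ℝ) (x : UnitAddTorus (Fin 3)) (v : EuclideanSpace ℝ (Fin 3)) => ρ s x * Literature.Analysis.FluidPDE.localMaxwellian 1 (θ s x) (u s x) v
   let Y := fun η : ℝ => 3 / (2 * Real.pi) * deriv Literature.MathematicalPhysics.KineticTheory.hsExcessFreeEnergy η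
   let W₀ := fun (s : ℝ) (x : UnitAddTorus (Fin 3)) => Y (σ ^ 3 * ρ s x) * ρ s x ^ 2 * θ s x
   let ψ := fun (N : ℕ) (s : ℝ) (x : UnitAddTorus (Fin 3)) (v : EuclideanSpace ℝ (Fin 3)) => (c N s x).1 + inner ℝ (c N s x).2.1 v + (c N s x).2.2 * ‖v‖ ^ 2 / 2
   let Lψ := fun (N : ℕ) (s : ℝ) (x : UnitAddTorus (Fin 3)) (v : EuclideanSpace ℝ (Fin 3)) => lam N * ∫ ω : Metric.sphere (0 : EuclideanSpace ℝ (Fin 3)) 1, (let y := G.translate x (ε N • (ω : EuclideanSpace ℝ (Fin 3))); ∫ w : EuclideanSpace ℝ (Fin 3), max (inner ℝ (v - w) ω) 0 * Y (σ ^ 3 * ρ s (G.translate x ((ε N / 2) • (ω : EuclideanSpace ℝ (Fin 3))))) * f s y w * (ψ N s x (v - inner ℝ (v - w) ω • (ω : EuclideanSpace ℝ (Fin 3))) + ψ N s y (w + inner ℝ (v - w) ω • (ω : EuclideanSpace ℝ (Fin 3))) - ψ N s x v - ψ N s y w)) ∂Literature.MathematicalPhysics.KineticTheory.sphereMeasu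re
   let Bψ := fun (N : ℕ) (s : ℝ) => ∫ x : UnitAddTorus (Fin 3), ∫ v : EuclideanSpace ℝ (Fin 3), f s x v * Lψ N s x v
   let I := fun (N : ℕ) (s : ℝ) => ∫ x : UnitAddTorus (Fin 3), (inner ℝ (c N s x).2.1 (Literature.Analysis.FunctionSpaces.Torus.gradient (W₀ s) x) + (c N s x).2.2 * Literature.Analysis.FunctionSpaces.Torus.divergence (fun y => W₀ s y • u s y) x)
   ∃ K M : ℝ, ∀ (N : ℕ), ∀ s ∈ Set.Icc 0 t, |(1 / 2 : ℝ) * Bψ N s + (2 * Real.pi / 3) * (lam N * ε N) * I N s| ≤ K * (lam N * ε N ^ 2) ∧ |I N s| ≤ M) := by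
  intro η₁ hη₁ han σ T hσ hσ1 ρ θ u hEul t ht hguard c κ hc hκ C hadm
  exact stub_transferBound η₁ hη₁ han σ T hσ hσ1 ρ θ u hEul t ht hguard c κ hc hκ C hadm
    (stub_transferReduction η₁ hη₁ han σ T hσ hσ1 ρ θ u hEul t ht hguard c κ hc hκ C hadm)

/-- **K2R clause (v) — Euler–Enskog consistency of the local Maxwellian on every admissible approximately-dual
family** (the skeleton's Prop `EnskogConsistency`, verbatim; registered stub `stub_enskogConsistency` of crux
stmt-AtomisticToContinuum-11592): `Res_N → 0`. Assembly `stub_consistencyAssembly` of G1 `stub_defectSplit`,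
G2 `stub_fluidMoments`, G3 `k2r_transferEstimate`, G4 `stub_correctorEstimate`.
[cite: CIP1994, §3.3] -/
theorem stub_enskogConsistency :
  ∀ η₁ : ℝ, 0 < η₁ → AnalyticOnNhd ℝ Literature.MathematicalPhysics.KineticTheory.hsExcessFreeEnergy (Set.Ioo 0 η₁) → (∀ η ∈ Set.Ioo 0 η₁, 0 < deriv Literature.MathematicalPhysics.KineticTheory.hsExcessFreeEnergy η) → (∀ η ∈ Set.Ioo 0 η₁, 0 < deriv (fun x : ℝ => x * Literature.MathematicalPhysics.KineticTheory.hsCompressibility x) η) → ∃ σ₀ : ℝ, 0 < σ₀ ∧ ∀ σ : ℝ, 0 < σ → σ < σ₀ → ∀ (T : ℝ) (ρ θ : ℝ → UnitAddTorus (Fin 3) → ℝ) (u : ℝ → UnitAddTorus (Fin 3) → EuclideanSpace ℝ (Fin 3)), Literature.MathematicalPhysics.KineticTheory.IsHardSphereEulerSolution σ T ρ u θ → ∀ t ∈ Set.Ioo 0 T, (∀ s ∈ Set.Icc 0 t, ∀ x, ρ s x * σ ^ 3 < η₁) → ∀ (c : ℕ → ℝ → UnitAddTorus (Fin 3) → ℝ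 × EuclideanSpace ℝ (Fin 3) × ℝ) (κ : ℕ → ℝ → UnitAddTorus (Fin 3) → EuclideanSpace ℝ (Fin 3) → ℝ), (∀ N, Continuous (Function.uncurry (c N))) → (∀ N, Continuous (fun p : ℝ × UnitAddTorus (Fin 3) × EuclideanSpace ℝ (Fin 3) => κ N p.1 p.2.1 p.2.2)) → (∃ C : ℝ, ∀ N s x x' v v', ‖c N s x‖ ≤ C ∧ dist (c N s x) (c N s x') ≤ C * dist x x' ∧ |κ N s x v| ≤ C * (1 + ‖v‖ ^ 2) ∧ |κ N s x v - κ N s x' v'| ≤ C * (1 + ‖v‖ ^ 2 + ‖v'‖ ^ 2) * (dist x x' + ‖v - v'‖)) → (let G := Literature.Analysis.FluidPDE.Torus.geometry (Fin 3); let ε := fun N : ℕ => Literature.MathematicalPhysics.KineticTheory.hsDiameter σ N; let lam := fun N : ℕ => (N : ℝ) * ε N ^ 2; let f := fun (s : ℝ) (x : UnitAddTorus (Fin 3)) (v : EuclideanSpace ℝ (Fin 3)) => ρ s x * Literature.Analysis.FluidPDE.localMaxwellian 1 (θ s x) (u s x) v; let Y := fun η : ℝ => 3 / (2 * Real.pi)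 * deriv Literature.MathematicalPhysics.KineticTheory.hsExcessFreeEnergy η; let φ := fun (N : ℕ) (s : ℝ) (x : UnitAddTorus (Fin 3)) (v : EuclideanSpace ℝ (Fin 3)) => (c N s x).1 + inner ℝ (c N s x).2.1 v + (c N s x).2.2 * ‖v‖ ^ 2 / 2 + (lam N)⁻¹ * κ N s x v; let L := fun (N : ℕ) (s : ℝ) (x : UnitAddTorus (Fin 3)) (v : EuclideanSpace ℝ (Fin 3)) => lam N * ∫ ω : Metric.sphere (0 : EuclideanSpace ℝ (Fin 3)) 1, (let y := G.translate x (ε N • (ω : EuclideanSpace ℝ (Fin 3))); ∫ w : EuclideanSpace ℝ (Fin 3), max (inner ℝ (v - w) ω) 0 * Y (σ ^ 3 * ρ s (G.translate x ((ε N / 2) • (ω : EuclideanSpace ℝ (Fin 3))))) * f s y w * (φ N s x (v - inner ℝ (v - w) ω • (ω : EuclideanSpace ℝ (Fin 3))) + φ N s y (w + inner ℝ (v - w) ω • (ω : EuclideanSpace ℝ (Fin 3))) - φ N s x v - φ N s y w)) ∂Literature.MathematicalPhysics.KineticTheory.sphereMeasure; (∃ η : ℕ → ℝ, Filter.Tendsto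 η Filter.atTop (nhds 0) ∧ ∀ᶠ N in Filter.atTop, (∀ x v, ContDiffOn ℝ 1 (fun r => φ N r (G.translate x (r • v)) v) (Set.Icc 0 t)) ∧ (∀ s ∈ Set.Icc 0 t, ∀ x v, |derivWithin (fun r => φ N r (G.translate x ((r - s) • v)) v) (Set.Icc 0 t) s + L N s x v| ≤ η N * (1 + ‖v‖ ^ 2))) → Filter.Tendsto (fun N : ℕ => (∫ x : UnitAddTorus (Fin 3), ∫ v : EuclideanSpace ℝ (Fin 3), f t x v * φ N t x v) - (∫ x : UnitAddTorus (Fin 3), ∫ v : EuclideanSpace ℝ (Fin 3), f 0 x v * φ N 0 x v) - ∫ s in Set.Icc 0 t, ∫ x : UnitAddTorus (Fin 3), ∫ v : EuclideanSpace ℝ (Fin 3), f s x v * (derivWithin (fun r => φ N r (G.translate x ((r - s) • v)) v) (Set.Icc 0 t) s + (1 / 2 : ℝ) * L N s x v)) Filter.atTop (nhds 0)) :=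
  stub_consistencyAssembly stub_defectSplit stub_fluidMoments k2r_transferEstimate stub_correctorEstimate

end Summit.AtomisticToContinuum.HydrodynamicLimit.Theorems.EnskogAdjointDuality
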